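import Summits.AtomisticToContinuum.Crystallization.Theorems.PalmUnimodularRigidityLayeredLawsSelectHcpSelectionDefs
import HarnessLib

/-!
# Route `ReggeStarCoercivity`, crux `DefectFreeCrystallizes` (stmt-AtomisticToContinuum-13603), line `palm-good-law`:
# definitions for the law-free core `stub_funnelCertificate` — hexagonal / cubic sites on the `1/20`-FUNNEL bond window `(0, 6/5)`

The registered law-free core of the line (`Cruxes/DefectFreeCrystallizes/Lines/palm_good_law.lean`, `stub_funnelCertificate`, lead c7 v22)
asks for a jointly measurable, root-covariant MARK `C ⊆ (configuration, point)`; the intended mark is "the point is a CUBIC site of the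
configuration", read on the bond graph of the charted `1/20`-funnel, whose bonds are the pairs at distance in the OPEN window `(0, 6/5)`
(the window of the landed funnel chart `PalmGoodLaw.FunnelChart.stub_funnelChart`).  Crux 9226's `IsHexSite` / `IsCubicSite`
(`…LayeredLawsSelectHcpSelectionDefs`) read the same combinatorics on the `1 %`-tube window `(0, 28/25]` (closed); on the funnel bonds reach
`1.155`, so the window — and, because of the closed/open endpoint, not merely the scale — must change.  This file is the funnel copy of that
vocabulary, verbatim up to the window, plus the mark as a subset of `Measure E3 × E3`:

* `Bond65 S x y` — `x, y ∈ S`, `0 < dist x y < 6/5`;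
* `IsHexSite65 S x` / `IsCubicSite65 S x` — two link triangles sharing a link edge (anticuboctahedral site) / its negation on a point of `S`;
* `cubicMark65` — `{(μ, y) | IsCubicSite65 (pts μ) y}`, the mark fed to `stub_covariantMecke` / `stub_funnelCertificate`.

All definitions are route-internal bookkeeping (`[folklore]`); the one theorem (`bond65_symm`) is the anchor.
-/

noncomputable section

namespace Summit.AtomisticToContinuum.Crystallization.Theorems.PalmGoodLaw.FunnelSites

open MeasureTheory Set
open Summit.AtomisticToContinuum.Crystallization.Theorems.PalmUnimodularRigidity.LayeredLawsSelectHcp (pts)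

/-- Euclidean `3`-space. [folklore] -/
local notation "E3" => EuclideanSpace ℝ (Fin 3)

/-- The BOND relation of a configuration `S` on the `1/20`-funnel: two points of `S` at distance in the OPEN window `(0, 6/5)` (the bond
window of the landed funnel chart; in a Barlow-charted configuration these are exactly the images of the touching pairs of the ideal
stacking). Symmetric, irreflexive, translation-covariant. [folklore] -/
def Bond65 (S : Set E3) (x y : E3) : Prop :=
  x ∈ S ∧ y ∈ S ∧ 0 < dist x y ∧ dist x y < 6 / 5

/-- `x` is a HEXAGONAL (hcp-like, anticuboctahedral) site of `S` on the funnel window: some bonded pair `p ~ q` of neighbours of `x` has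
TWO distinct common neighbours `t, b` that are also neighbours of `x` (two link triangles sharing the link edge `pq`; in the cuboctahedron
every link edge lies in exactly one triangle).  Verbatim `LayeredLawsSelectHcp.IsHexSite` with `Bond65`. [folklore] -/
def IsHexSite65 (S : Set E3) (x : E3) : Prop :=
  ∃ p q t b : E3, t ≠ b ∧ Bond65 S x p ∧ Bond65 S x q ∧ Bond65 S x t ∧ Bond65 S x b ∧ Bond65 S p q ∧
    Bond65 S t p ∧ Bond65 S t q ∧ Bond65 S b p ∧ Bond65 S b q

/-- `x` is a CUBIC (fcc-like, cuboctahedral) site of `S` on the funnel window — a stacking fault passes through `x`: a point of `S` that is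
not hexagonal.  Verbatim `LayeredLawsSelectHcp.IsCubicSite` with `Bond65`. [folklore] -/
def IsCubicSite65 (S : Set E3) (x : E3) : Prop :=
  x ∈ S ∧ ¬ IsHexSite65 S x

/-- **The cubic mark** of the law-free core: the set of pairs (configuration, point) such that the point is a cubic site of the atoms of
the configuration, on the funnel window.  Intended instance of the mark `C` of `stub_funnelCertificate` / `stub_covariantMecke`
(root-covariant: `(θ_y μ, −y) ∈ cubicMark65 ↔ (μ, 0) ∈ cubicMark65`, since translations are isometries). [folklore] -/
def cubicMark65 : Set (Measure E3 × E3) := {p | IsCubicSite65 (pts p.1) p.2}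

/-- Bonds are symmetric (anchor of this definitions file). [folklore] -/
theorem bond65_symm : ∀ (S : Set E3) (x y : E3), Bond65 S x y → Bond65 S y x := by
  intro S x y h
  obtain ⟨hx, hy, h0, h1⟩ := h
  rw [dist_comm] at h0 h1
  exact ⟨hy, hx, h0, h1⟩

/-- Definitional unfolding of the mark. [folklore] -/
theorem mem_cubicMark65_iff (μ : Measure E3) (y : E3) : (μ, y) ∈ cubicMark65 ↔ IsCubicSite65 (pts μ) y := Iff.rfl

end Summit.AtomisticToContinuum.Crystallization.Theorems.PalmGoodLaw.FunnelSites

end
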